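import Summits.PneNP.PneNP.Theorems.ChebyshevTracialDesignHSymmetricAmplitudeOneExp
import HarnessLib

/-!
# Cell pnp-psdrank, route `ChebyshevTracialDesign`: the 𝒜₁ rung with `H`-symmetric amplitudes IN THE CRUX'S VOCABULARY — the normalised tracial
# value of the design weight on the psd rectangles `X_U = ψ(|U∩H|)·B_UB_Uᵀ` — brick 146d (crux `TracialDecayExp20`, stmt-PneNP-19878)

Brick 146d (prover g29; MEMO-32 §8). The crux `TracialDecayExp20` asks `TracialValueLEAt (levelWeight n t C w) (e^{−a·dq n}) r`, i.e.
`(Σ_U Σ_M W(U,M)·tr(X_U Y_M))/r ≤ e^{−a·dq n}` for EVERY tight-orthogonal psd rectangle `(X, Y)` of dimension `r` with `r²n < e^{a·dq n}`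
(`Literature.Combinatorics.Optimization.IsPsdRect`: `0 ⪯ X_U, Y_M ⪯ I`, `X_UY_M = 0` on the tight pairs). Brick 146c
(`…HSymmetricAmplitudeOneExp.hSymmetric_amplitudeOne_value_le_exp`) gives, for the SUB-CLASS of psd rectangles whose cut side is an
`H`-symmetric amplitude times a degree-one Gram contraction, the same kind of bound with a polynomial loss and NO dimension budget:
* **`hSymmetric_amplitudeOne_tracialValue_le`**: for some `a > 0` and all large even `n`, every balanced exact design of the crux's shape, every
  balanced block `2|H| = n`, every `0 ≤ ψ ≤ G`, every `β : [n] → ℝ^{r×m}` with `B_UB_Uᵀ ⪯ I` on the `t`-cuts (`B_U = Σ_p x_p(U)β_p`), and every psd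
  rectangle `(X, Y)` of dimension `r ≥ 1` (`IsPsdRect X Y`) with `X_U = ψ(|U∩H|)·B_UB_Uᵀ`:
  `(Σ_U Σ_M W(U,M)·tr(X_U Y_M))/r ≤ 2·10⁸·G·n⁶·e^{−a·dq n}`.
READING: on this class the crux's inequality holds up to the factor `2·10⁸·G·n⁶` (absorbed by any smaller rate `a′ < a` for large `n`), for EVERY
dimension `r` — the budget `r²n < e^{a·dq n}` and the tightness `X_UY_M = 0` are not used. WHAT THIS FILE DOES NOT DO: other cut sides (spread
amplitudes, higher-degree factors), i.e. `TracialDecayExp20` itself; psd rank of P_PM(K_n); P vs NP.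
[cite: GriblingDelaatLaurent2019, §5] [cite: BrietDadushPokutta2014, Thm. 6 (§3)] [cite: Rothvoss2017, §2 and Lemma 7 (PDF pp. 5–8)]
Stature: support/instrument (kernel lane, no defs, axioms standard) — rung-type statement for a named strategy class. Supports stmt-PneNP-19878.
-/

set_option linter.dupNamespace false -- `Summit.PneNP.PneNP.…`: summit = sub-problem (D-0017)

noncomputable section

namespace Summit.PneNP.PneNP.Theorems.ChebyshevTracialDesignHSymmetricAmplitudeOneTracial

open Finset Matrix Literature.Barriers.PneNP Literature.Combinatorics.Optimization
open Summit.PneNP.PneNP.Theorems.ChebyshevTracialDesignHSymmetricAmplitudeOneExp (hSymmetric_amplitudeOne_value_le_exp)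

variable {n : ℕ}

/-- **THE 𝒜₁ RUNG WITH `H`-SYMMETRIC AMPLITUDES, TRACIAL FORM (brick 146d).** For some `a > 0` and all large even `n`: for every balanced exact
design `(t, C, w)` of degree `dq n` on levels `≤ Tq n` with `Σ|w| ≤ 20`, every balanced block `2|H| = n`, every mask `0 ≤ ψ ≤ G`, every degree-one
factor with `B_UB_Uᵀ ⪯ I` on the `t`-cuts, and every psd rectangle `(X, Y)` of dimension `r ≥ 1` with `X_U = ψ(|U∩H|)·B_UB_Uᵀ`:
`(Σ_U Σ_M W(U,M)·tr(X_U Y_M))/r ≤ 2·10⁸·G·n⁶·e^{−a·dq n}`. [cite: GriblingDelaatLaurent2019, §5] [cite: Rothvoss2017, §2 and Lemma 7 (PDF pp. 5–8)] -/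
theorem hSymmetric_amplitudeOne_tracialValue_le :
    ∃ a : ℝ, 0 < a ∧ ∃ n₀ : ℕ, ∀ n : ℕ, n₀ ≤ n → Even n → ∀ {t : ℕ} {C : Finset ℕ} {w : ℕ → ℝ},
    IsBalancedDesign n t (Tq n) (dq n) 20 C w →
    ∀ (H : Finset (Fin n)), 2 * H.card = n →
    ∀ (ψ : ℤ → ℝ) {G : ℝ}, 0 ≤ G → (∀ x, 0 ≤ ψ x) → (∀ x, ψ x ≤ G) →
    ∀ {r m : ℕ} (β : Fin n → Matrix (Fin r) (Fin m) ℝ),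
    (∀ U : OddSet n, U.1.card = t →
      (1 - (∑ p, (if p ∈ U.1 then (1 : ℝ) else 0) • β p) * (∑ p, (if p ∈ U.1 then (1 : ℝ) else 0) • β p)ᵀ).PosSemidef) →
    ∀ (X : OddSet n → Matrix (Fin r) (Fin r) ℝ) (Y : PMatch n → Matrix (Fin r) (Fin r) ℝ), IsPsdRect X Y →
    (∀ U : OddSet n, X U = ψ ((U.1 ∩ H).card : ℤ) •
      ((∑ p, (if p ∈ U.1 then (1 : ℝ) else 0) • β p) * (∑ p, (if p ∈ U.1 then (1 : ℝ) else 0) • β p)ᵀ)) → 0 < r →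
    (∑ U : OddSet n, ∑ M : PMatch n, levelWeight n t C w U M * (X U * Y M).trace) / r ≤
      2 * 10 ^ 8 * G * (n : ℝ) ^ 6 * Real.exp (-(a * dq n)) := by
  obtain ⟨a, ha, n₀, h⟩ := hSymmetric_amplitudeOne_value_le_exp
  refine ⟨a, ha, n₀, ?_⟩
  intro n hn hev t C w hdes H hH ψ G hG0 hψ0 hψG r m β hB X Y hXY hX hr
  have key := h n hn hev hdes H hH ψ hG0 hψ0 hψG β hB Y hXY.2.1
  have hrw : ∑ U : OddSet n, ∑ M : PMatch n, levelWeight n t C w U M * (X U * Y M).trace =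
      ∑ U : OddSet n, ∑ M : PMatch n, levelWeight n t C w U M * (ψ ((U.1 ∩ H).card : ℤ) *
        ((∑ p, (if p ∈ U.1 then (1 : ℝ) else 0) • β p) * (∑ p, (if p ∈ U.1 then (1 : ℝ) else 0) • β p)ᵀ * Y M).trace) := by
    refine Fintype.sum_congr _ _ fun U => Fintype.sum_congr _ _ fun M => ?_
    rw [hX U, Matrix.smul_mul, Matrix.trace_smul, smul_eq_mul]
  have hrpos : (0 : ℝ) < r := by exact_mod_cast hr
  rw [hrw, div_le_iff₀ hrpos]
  exact key

end Summit.PneNP.PneNP.Theorems.ChebyshevTracialDesignHSymmetricAmplitudeOneTracial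

end
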